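import Summits.BirchSwinnertonDyer.Rank1Residual.Iwasawa.NonsplitTowerPrimeToP
import Summits.BirchSwinnertonDyer.Rank1Residual.Iwasawa.InertiaCohomologyPTorsionFinite
import Literature.NumberTheory.EllipticCurves.SelmerInftyTorsionFiniteProofs
import Literature.NumberTheory.EllipticCurves.PointDivisibilityProofs
import HarnessLib

/-!
# BSD rank-≤1 residual cell — `H¹(K_{∞,η}, E[p])` and the `p`-torsion of `𝓗_v(K_∞)` are FINITE
# at a finitely decomposed `v ∤ p` (TOOL; row T-NSP, FILE B: the located gap 'P-α')

HONEST FRAMING (cell `b2b-bsdres-*`, team n1011, verbatim): prove what is provable now; shrink each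
hard class to its core with data; no claim beyond stated classes. Research route; TOOL theorems
only — no definition, no named fact, nothing booked, no residual-map mark moved, no class closed.
Row T-NSP of `cells/n1011/OWNERS.md` (seat n1011-p12 GEN 12; idle rule R3-25 (f)), FILE B: the
GLOBAL-currency reading of FILE A (`Iwasawa/NonsplitTowerPrimeToP.lean`) for `B = E[p]`, in the
vocabulary of `GreenbergSelmer` (`decomp v = D_v`, the decomposition group of the chosen place above
`v`) and of `Iwasawa/InertiaCohomologyPTorsionFinite.lean` (p12 GEN 7–8, the INERTIA-level twin):

* `resSubgroup_inertia_injective_of_isPrimary` — FILE A's injectivity `H¹(Hi, B) → H¹(I_𝔐, B)` for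
  every `p`-PRIMARY TORSION discrete `B`, finite or not (e.g. `E[p^∞]`; the cocycle has finite image);
* `exists_not_mem_localSubgroup_iff_exists_mem_decomp` — the local and global spellings of
  "`v` not split completely in `K_∞/K`" agree;
* `finite_subgroupH1_kerSubgroup_inf_decomp_geomTorsion` — for `E = W` elliptic over a number field
  `K`, a prime `p`, ANY `ℤ_p`-extension `κ`, a finite `v ∤ p` NOT split completely in `K_∞/K`
  (`hns : ∃ δ ∈ D_v, δ ∉ ker κ`): **`H¹(Gal(K̄/K_∞) ∩ D_v, E[p])` is finite of order `≤ p²`**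
  (inflation along `Γ_{K_v} ⊇ Hi ↠ ker κ ⊓ D_v`, `resH1Hom_injective_of_surjective`, into the local
  `H¹(Hi, E[p])`, bounded by FILE A's `finite_subgroupH1_and_natCard_le`);
* `finite_setOf_nsmul_eq_zero_subgroupH1_kerSubgroup_inf_decomp` — **the `p`-torsion of
  `𝓗_v(K_∞) = H¹(K_{∞,η}, E[p^∞])` is finite** (Kummer: `H¹(·, E[p]) ↠ H¹(·, E[p^∞])[p]`,
  `exists_torsionToPrimaryH1Sub_eq`) — the input of Greenberg–Vatsal 2000 §2 (p. 20) making
  `S^{Σ₀}(E/K_∞)/S(E/K_∞)` of finite `p`-torsion, here for every number field and every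
  `ℤ_p`-extension at its finitely decomposed places (the located gap 'P-α' of p12 GEN 6);
* `…_of_isCyclotomic` — the cyclotomic `ℤ_p`-extension, where every `v ∤ p` is finitely decomposed
  (`Iwasawa.exists_mem_decomp_apply_ne_one_of_isCyclotomic`; `K : Type`).

* `resOfLe_inertia_injective_geomPrimaryTorsion` — **`H¹(ker κ ⊓ D_v, E[p^∞]) → H¹(I_v, E[p^∞])`
  is injective** (`W.resOfLe p` along `inertia v ≤ ker κ ⊓ decomp v`): Greenberg's local condition
  at `v ∤ p` over `K_∞` IS the unramified one.

NOT claimed: the split-completely case; `v ∣ p`; coranks / divisibility of `𝓗_v(K_∞)` (`cd_p ≤ 1`);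
no consumer END of the cell binds these today (consumer honesty, lead R5-96). Axioms standard.

References: [GreenbergVatsal2000] §2 (pp. 20–21); [GreenbergLNM1716] Greenberg §2–§3 (Lemma 3.3).
-/

noncomputable section

open scoped Classical NNReal
open NumberField IsDedekindDomain Field ValuativeRel

universe u

namespace Summit.BirchSwinnertonDyer.Rank1Residual.Iwasawa.NonsplitTower

open Literature.NumberTheory.EllipticCurves Literature.NumberTheory.GaloisRepresentations
  IsDedekindDomain.HeightOneSpectrum ContinuousCohomology
  Summit.BirchSwinnertonDyer.Rank1Residual.Iwasawa.NonsingularTower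

variable {K : Type u} [Field K] [NumberField K]
  {v : HeightOneSpectrum (𝓞 K)} {p : ℕ} [Fact p.Prime] (κ : ZpExtension K p)

/-! ## Restriction to inertia is injective for every `p`-primary torsion module (e.g. `E[p^∞]`) -/

section Primary

/-- **FILE A's injectivity for every `p`-PRIMARY TORSION discrete `Γ_{K_v}`-module `B`, finite or
not** (e.g. `B = E[p^∞]`): a kernel cocycle has compact hence finite image in the discrete `B`, so one
`p^k` kills its values and the averaging of `resSubgroup_inertia_injective` runs verbatim.
[cite: GreenbergLNM1716, §3 Lemma 3.3 (proof, p. 87)] -/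
theorem resSubgroup_inertia_injective_of_isPrimary (hpv : (p : 𝓞 K) ∉ v.asIdeal)
    (hns : ∃ σ : absoluteGaloisGroup (v.adicCompletion K),
      σ ∉ localSubgroup κ.kerSubgroup (v.adicCompletion K))
    {𝔐 : Ideal v.localAbsIntegers} (h𝔐 : 𝔐 ∈ v.localPrimesAbove)
    {B : Type u} [AddCommGroup B] [DistribMulAction (absoluteGaloisGroup (v.adicCompletion K)) B]
    [TopologicalSpace B] [DiscreteTopology B] (hB : ∀ b : B, ∃ k : ℕ, p ^ k • b = 0)
    (hcont : ∀ b : B, Continuous fun g : absoluteGaloisGroup (v.adicCompletion K) ↦ g • b) :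
    Function.Injective (ResKernel.resSubgroup
      ((𝔐.inertia (absoluteGaloisGroup (v.adicCompletion K))).subgroupOf
        (localSubgroup κ.kerSubgroup (v.adicCompletion K))) B) := by
  -- notation
  let G : Type u := absoluteGaloisGroup (v.adicCompletion K)
  let Hi : Subgroup G := localSubgroup κ.kerSubgroup (v.adicCompletion K)
  let I : Subgroup G := 𝔐.inertia G
  have hp : (p : ℕ).Prime := Fact.out
  haveI : CharZero (v.adicCompletion K) :=
    charZero_of_injective_algebraMap (algebraMap K (v.adicCompletion K)).injective
  haveI hIn : I.Normal := v.inertia_normal_of_mem_localPrimesAbove h𝔐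
  have hI : ∀ σ ∈ I, σ ∈ Hi := fun σ hσ ↦
    (mem_localSubgroup_iff _ _ σ).mpr
      (ZpExtension.inertia_le_kerSubgroup_holds K p κ hpv (primeBelow_mem_primesAbove h𝔐)
        (v.resGalOfEmb_mem_inertia_primeBelow (closureEmb (K := K) (v.adicCompletion K)) 𝔐 hσ))
  have hcontH : ∀ b : B, Continuous fun h : Hi ↦ h • b := fun b ↦
    (hcont b).comp continuous_subtype_val
  -- reduce to the kernel
  refine (injective_iff_map_eq_zero _).mpr fun x hx ↦ ?_
  obtain ⟨φ, rfl, hφI⟩ := ResKernel.exists_cocycle_of_res_eq_zero (I.subgroupOf Hi) B hcontH x hx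
  -- an open normal `N ≤ G` with `Hi ∩ N` inside the zero set of `φ`
  have hZopen : IsOpen (ResKernel.zeroSubgroup φ : Set Hi) := ResKernel.isOpen_zeroSubgroup φ
  obtain ⟨V, hVopen, hV⟩ := isOpen_induced_iff.mp hZopen
  have h1V : (1 : G) ∈ V := by
    have : (1 : Hi) ∈ (Subtype.val ⁻¹' V : Set Hi) := by
      rw [hV]; exact (ResKernel.zeroSubgroup φ).one_mem
    exact this
  obtain ⟨N, hN⟩ := ProfiniteGrp.exist_openNormalSubgroup_sub_open_nhds_of_one hVopen h1V
  have hNzero : ∀ h : Hi, (h : G) ∈ (N : Subgroup G) → φ.1 h = 0 := by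
    intro h hh
    have : h ∈ (Subtype.val ⁻¹' V : Set Hi) := hN hh
    rw [hV] at this
    exact this
  -- `M = N·I`, and `φ` vanishes on `Hi ∩ M`
  let M : Subgroup G := (N : Subgroup G) ⊔ I
  haveI hMn : M.Normal := Subgroup.sup_normal _ _
  have hMopen : IsOpen (M : Set G) :=
    Subgroup.isOpen_mono (le_sup_left : (N : Subgroup G) ≤ M) N.isOpen'
  have hMzero : ∀ x : Hi, (x : G) ∈ M → φ.1 x = 0 := by
    intro x hx
    have hx' : (x : G) ∈ ((M : Subgroup G) : Set G) := hx
    rw [Subgroup.normal_mul] at hx'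
    obtain ⟨n, hn, τ, hτ, hnτ⟩ := Set.mem_mul.mp hx'
    have hτH : τ ∈ Hi := hI τ hτ
    have hnH : n ∈ Hi := by
      have : n = (x : G) * τ⁻¹ := by rw [← hnτ, mul_inv_cancel_right]
      rw [this]; exact Hi.mul_mem x.2 (Hi.inv_mem hτH)
    have hx_eq : x = (⟨n, hnH⟩ : Hi) * ⟨τ, hτH⟩ := Subtype.ext hnτ.symm
    rw [hx_eq, φ.2, hNzero ⟨n, hnH⟩ hn, hφI ⟨τ, hτH⟩ (Subgroup.mem_subgroupOf.mpr hτ), map_zero,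
      add_zero]
  have hconst : ∀ (h x : Hi), (x : G) ∈ M → φ.1 (h * x) = φ.1 h := by
    intro h x hx
    rw [φ.2, hMzero x hx, map_zero, add_zero]
  -- the finite quotient `Q = Hi / (Hi ∩ M)`, of order prime to `p`
  let MH : Subgroup Hi := M.subgroupOf Hi
  haveI : MH.Normal := inferInstance
  have hHiclosed : IsClosed (Hi : Set G) := by
    show IsClosed ((localSubgroup κ.kerSubgroup (v.adicCompletion K) : Subgroup G) : Set G)
    exact κ.isClosed_kerSubgroup.preimage (map_continuous (resGal (K := K) (v.adicCompletion K)))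
  haveI : CompactSpace Hi := isCompact_iff_compactSpace.mp hHiclosed.isCompact
  have hMHopen : IsOpen (MH : Set Hi) := hMopen.preimage continuous_subtype_val
  haveI : Finite (Hi ⧸ MH) := Subgroup.quotient_finite_of_isOpen MH hMHopen
  haveI : Fintype (Hi ⧸ MH) := Fintype.ofFinite _
  have hcard : Nat.card (Hi ⧸ MH) = M.relIndex Hi := (Subgroup.index_eq_card MH).symm
  have hcop : (Nat.card (Hi ⧸ MH)).Coprime p := by
    rw [hcard]
    exact relIndex_sup_inertia_coprime κ hpv hns h𝔐 (N : Subgroup G) N.isOpen'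
  -- the averaging sum
  let S : B := ∑ q : Hi ⧸ MH, φ.1 q.out
  have hout : ∀ (h : Hi) (q : Hi ⧸ MH), φ.1 ((QuotientGroup.mk h * q).out) = φ.1 h + h • φ.1 q.out := by
    intro h q
    obtain ⟨x, hx⟩ := QuotientGroup.mk_out_eq_mul (s := MH) (h * q.out)
    have hq : (QuotientGroup.mk h : Hi ⧸ MH) * q = QuotientGroup.mk (h * q.out) := by
      rw [QuotientGroup.mk_mul, QuotientGroup.out_eq']
    rw [hq, hx, hconst _ _ (Subgroup.mem_subgroupOf.mp x.2), φ.2]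
    rfl
  have hS : ∀ h : Hi, (Nat.card (Hi ⧸ MH)) • φ.1 h = S - h • S := by
    intro h
    have hsum : ∑ q : Hi ⧸ MH, φ.1 ((QuotientGroup.mk h * q).out) = S :=
      Fintype.sum_equiv (Equiv.mulLeft (QuotientGroup.mk h : Hi ⧸ MH)) _ _ (fun _ ↦ rfl)
    simp only [hout, Finset.sum_add_distrib, Finset.sum_const, Finset.card_univ, ← Finset.smul_sum]
      at hsum
    rw [Nat.card_eq_fintype_card, eq_sub_iff_add_eq]
    exact hsum
  -- invert `m` modulo `p^k`
  -- a uniform exponent on the (finite) image of the cocycle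
  obtain ⟨k, hk⟩ : ∃ k : ℕ, ∀ h : Hi, p ^ k • φ.1 h = 0 := by
    have hfin : (Set.range φ.1).Finite := (isCompact_range φ.1.continuous).finite_of_discrete
    obtain ⟨T, hT⟩ := hfin.exists_finset_coe
    choose kb hkb using hB
    refine ⟨∑ b ∈ T, kb b, fun h ↦ ?_⟩
    have hmem : φ.1 h ∈ T := by
      rw [← Finset.mem_coe, hT]; exact ⟨h, rfl⟩
    obtain ⟨c, hc⟩ : ∃ c, ∑ b ∈ T, kb b = kb (φ.1 h) + c :=
      ⟨∑ b ∈ T.erase (φ.1 h), kb b, (Finset.add_sum_erase T kb hmem).symm⟩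
    rw [hc, pow_add, mul_comm, mul_smul, hkb, smul_zero]
  obtain ⟨m', -, hm'⟩ := Nat.exists_mul_mod_eq_one_of_coprime (hcop.pow_right (k + 1))
    (Nat.one_lt_pow (Nat.succ_ne_zero k) hp.one_lt)
  have hmm' : ∀ h : Hi, (Nat.card (Hi ⧸ MH) * m') • φ.1 h = φ.1 h := by
    intro h
    obtain ⟨q, hq⟩ : ∃ q, Nat.card (Hi ⧸ MH) * m' = p ^ (k + 1) * q + 1 :=
      ⟨Nat.card (Hi ⧸ MH) * m' / p ^ (k + 1), by
        have h := Nat.div_add_mod (Nat.card (Hi ⧸ MH) * m') (p ^ (k + 1)); rw [hm'] at h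
        exact h.symm⟩
    rw [hq, add_smul, one_smul, mul_comm, mul_smul, pow_succ', mul_smul, hk h, smul_zero, smul_zero,
      zero_add]
  -- `φ` is the coboundary of `-(m' • S)`
  rw [oneCocycleClass_eq_zero_iff]
  refine ⟨-(m' • S), fun h ↦ ?_⟩
  show φ.1 h = h • (-(m' • S)) - -(m' • S)
  rw [smul_neg, sub_neg_eq_add, neg_add_eq_sub, ← hmm' h, mul_comm, mul_smul, hS h, smul_sub,
    smul_comm]

end Primary

/-! ## P-α: `H¹(K_{∞,η}, E[p])` finite and the `p`-torsion of `𝓗_v(K_∞)` finite (GLOBAL currency) -/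

section Global

open Literature.NumberTheory.EllipticCurves.GreenbergSelmer WeierstrassCurve

/-- The two spellings of "`v` is not split completely in `K_∞/K`" agree: LOCALLY some
`σ ∈ Γ_{K_v}` lies outside `Hi = localSubgroup κ.kerSubgroup K_v`, GLOBALLY some element of the
decomposition group `D_v = decomp v` lies outside `ker κ` (`D_v = res Γ_{K_v}`, `mem_decomp_iff`,
`resGal = absGaloisRestrict`). [folklore] -/
theorem exists_not_mem_localSubgroup_iff_exists_mem_decomp :
    (∃ σ : absoluteGaloisGroup (v.adicCompletion K),
        σ ∉ localSubgroup κ.kerSubgroup (v.adicCompletion K)) ↔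
      ∃ δ ∈ decomp (K := K) v, δ ∉ κ.kerSubgroup := by
  constructor
  · rintro ⟨σ, hσ⟩
    exact ⟨resGal (K := K) (v.adicCompletion K) σ,
      (mem_decomp_iff v _).mpr ⟨σ, by rw [← resGal_eq_absGaloisRestrict]⟩,
      fun h ↦ hσ ((mem_localSubgroup_iff _ _ σ).mpr h)⟩
  · rintro ⟨δ, ⟨σ, rfl⟩, hδ⟩
    exact ⟨σ, fun h ↦ hδ ((mem_localSubgroup_iff _ _ σ).mp h)⟩

variable (W : WeierstrassCurve K) [W.IsElliptic]

/-- **`H¹(K_{∞,η}, E[p])` is finite, of order at most `p²`, at a finite `v ∤ p` not split completely in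
the `ℤ_p`-extension** — in the GLOBAL currency of `GreenbergSelmer` / `Iwasawa/InertiaCohomologyPTorsionFinite`:
the group is `Gal(K̄/K_∞) ∩ D_v = κ.kerSubgroup ⊓ decomp v` (the decomposition group of the place of
`K_∞` above `v` singled out by the chosen embedding), the module is `E[p] = geomTorsion W p` with its
`Γ_K`-action, and the non-split hypothesis reads `∃ δ ∈ D_v, δ ∉ ker κ` (the conclusion shape of
`Iwasawa.exists_mem_decomp_apply_ne_one_of_isCyclotomic`). Proof: inflation along the surjection
`Hi ↠ ker κ ⊓ D_v` (`resH1Hom_injective_of_surjective`) into the LOCAL `H¹(Hi, E[p])`, which is finite of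
order `≤ #E[p] = p²` by `finite_subgroupH1_and_natCard_le`. [cite: GreenbergLNM1716, §3 Lemma 3.3 (proof, p. 87)] -/
theorem finite_subgroupH1_kerSubgroup_inf_decomp_geomTorsion (hpv : (p : 𝓞 K) ∉ v.asIdeal)
    (hns : ∃ δ ∈ decomp (K := K) v, δ ∉ κ.kerSubgroup) :
    Finite (Literature.NumberTheory.EllipticCurves.subgroupH1 (κ.kerSubgroup ⊓ decomp (K := K) v)
      (WeierstrassCurve.geomTorsion W (p : ℤ))) ∧
    Nat.card (Literature.NumberTheory.EllipticCurves.subgroupH1 (κ.kerSubgroup ⊓ decomp (K := K) v)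
      (WeierstrassCurve.geomTorsion W (p : ℤ))) ≤ p ^ 2 := by
  have hp : (p : ℕ).Prime := Fact.out
  let G : Type u := absoluteGaloisGroup (v.adicCompletion K)
  let Hi : Subgroup G := localSubgroup κ.kerSubgroup (v.adicCompletion K)
  let Hg : Subgroup (absoluteGaloisGroup K) := κ.kerSubgroup ⊓ decomp (K := K) v
  -- the local action of `Γ_{K_v}` on `E[p]` (through the chosen embedding), local to this proof
  letI : DistribMulAction G (WeierstrassCurve.geomTorsion W (p : ℤ)) :=
    DistribMulAction.compHom _ (absGaloisRestrict K (v.adicCompletion K)).toMonoidHom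
  haveI : ContinuousSMul (absoluteGaloisGroup K) (WeierstrassCurve.geomTorsion W (p : ℤ)) :=
    WeierstrassCurve.continuousSMul_geomTorsion W (WeierstrassCurve.isOpen_stabilizer_point_holds W) _
  have hcont : ∀ b : WeierstrassCurve.geomTorsion W (p : ℤ), Continuous fun σ : G ↦ σ • b := by
    intro b
    change Continuous fun σ : G ↦ absGaloisRestrict K (v.adicCompletion K) σ • b
    exact (continuous_id.smul continuous_const :
      Continuous fun τ : absoluteGaloisGroup K ↦ τ • b).comp
        (absGaloisRestrict K (v.adicCompletion K)).continuous_toFun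
  -- `E[p]` is finite of order `p²`, `p`-torsion
  haveI : Finite (WeierstrassCurve.geomTorsion W (p : ℤ)) :=
    WeierstrassCurve.finite_torsionPoints_holds W (AlgebraicClosure K) (by exact_mod_cast hp.ne_zero)
  have hcard : Nat.card (WeierstrassCurve.geomTorsion W (p : ℤ)) = p ^ 2 :=
    WeierstrassCurve.card_torsionPoints_eq_sq_holds W (AlgebraicClosure K) (by
      haveI : CharZero (AlgebraicClosure K) :=
        charZero_of_injective_algebraMap (algebraMap K (AlgebraicClosure K)).injective
      exact_mod_cast hp.ne_zero)
  have hB : ∃ k : ℕ, ∀ b : WeierstrassCurve.geomTorsion W (p : ℤ), p ^ k • b = 0 := by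
    refine ⟨1, fun b ↦ ?_⟩
    rw [pow_one, ← natCast_zsmul]
    apply Subtype.ext
    rw [AddSubgroupClass.coe_zsmul, ZeroMemClass.coe_zero]
    exact (Submodule.mem_torsionBy_iff _ _).mp b.2
  have hℓ := ringChar_residueField_prime (F := v.adicCompletion K)
  have hne := v.ringChar_residueField_adicCompletion_ne hpv
  have hBcard : (Nat.card (WeierstrassCurve.geomTorsion W (p : ℤ))).Coprime
      (ringChar 𝓀[v.adicCompletion K]) := by
    rw [hcard]
    exact ((Nat.coprime_primes hp hℓ).2 (Ne.symm hne)).pow_left 2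
  -- the local non-split hypothesis
  have hns' : ∃ σ : G, σ ∉ Hi := by
    obtain ⟨δ, ⟨σ, rfl⟩, hδ⟩ := hns
    exact ⟨σ, fun h ↦ hδ ((mem_localSubgroup_iff _ _ σ).mp h)⟩
  -- the local finiteness
  obtain ⟨hfin, hle⟩ := finite_subgroupH1_and_natCard_le κ hpv hns'
    (B := WeierstrassCurve.geomTorsion W (p : ℤ)) hB hBcard hcont
  -- inflation along `Hi ↠ ker κ ⊓ D_v`
  let θ : Hi →ₜ* Hg :=
    { toFun := fun x ↦ ⟨absGaloisRestrict K (v.adicCompletion K) x,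
        ⟨(mem_localSubgroup_iff _ _ (x : G)).mp x.2, ⟨(x : G), rfl⟩⟩⟩
      map_one' := Subtype.ext (by simp)
      map_mul' := fun x y ↦ Subtype.ext (by simp)
      continuous_toFun :=
        ((absGaloisRestrict K (v.adicCompletion K)).continuous_toFun.comp
          continuous_subtype_val).subtype_mk _ }
  have hθ : Function.Surjective θ := by
    rintro ⟨y, hyk, ⟨x, rfl⟩⟩
    exact ⟨⟨x, (mem_localSubgroup_iff _ _ x).mpr hyk⟩, rfl⟩
  have hinj := resH1Hom_injective_of_surjective (M := WeierstrassCurve.geomTorsion W (p : ℤ))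
    θ hθ fun _ _ ↦ rfl
  haveI := hfin
  exact ⟨Finite.of_injective _ hinj, (Nat.card_le_card_of_injective _ hinj).trans (hle.trans hcard.le)⟩

/-- **P-α: the `p`-torsion of `𝓗_v(K_∞) = H¹(K_{∞,η}, E[p^∞])` is finite at a finite `v ∤ p` not
split completely in the `ℤ_p`-extension** (Greenberg–Vatsal 2000, §2, p. 20: the input making
`S^{Σ₀}(E/ℚ_∞)/S(E/ℚ_∞)` of finite `p`-torsion; Greenberg LNM 1716 §2): the classes of
`H¹(ker κ ⊓ D_v, E[p^∞])` killed by `p` are images of `H¹(ker κ ⊓ D_v, E[p])`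
(`exists_torsionToPrimaryH1Sub_eq`, Kummer), a finite group by the previous theorem.
[cite: GreenbergVatsal2000, §2 Cor. (2.3) (arXiv:math/9906215 pp. 20–21)] -/
theorem finite_setOf_nsmul_eq_zero_subgroupH1_kerSubgroup_inf_decomp
    (hpv : (p : 𝓞 K) ∉ v.asIdeal) (hns : ∃ δ ∈ decomp (K := K) v, δ ∉ κ.kerSubgroup) :
    Set.Finite {x : W.subgroupH1 p (κ.kerSubgroup ⊓ decomp (K := K) v) | p • x = 0} := by
  haveI := (finite_subgroupH1_kerSubgroup_inf_decomp_geomTorsion κ W hpv hns).1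
  refine ((Set.finite_univ (α := Literature.NumberTheory.EllipticCurves.subgroupH1
    (κ.kerSubgroup ⊓ decomp (K := K) v) (WeierstrassCurve.geomTorsion W (p : ℤ)))).image
    (W.torsionToPrimaryH1Sub p (κ.kerSubgroup ⊓ decomp (K := K) v))).subset fun y hy ↦ ?_
  obtain ⟨z, hz⟩ := W.exists_torsionToPrimaryH1Sub_eq p W.zsmul_geomPoints_surjective_holds hy
  exact ⟨z, Set.mem_univ _, hz⟩

/-- **The same for the CYCLOTOMIC `ℤ_p`-extension, where no `v ∤ p` splits completely** (`K : Type`;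
`Iwasawa.exists_mem_decomp_apply_ne_one_of_isCyclotomic`). [cite: GreenbergVatsal2000, §2 Cor. (2.3) (arXiv:math/9906215 pp. 20–21)] -/
theorem finite_setOf_nsmul_eq_zero_subgroupH1_kerSubgroup_inf_decomp_of_isCyclotomic
    {L : Type} [Field L] [NumberField L] (V : WeierstrassCurve L) [V.IsElliptic] {q : ℕ} [Fact q.Prime]
    {μ : ZpExtension L q} (hμ : μ.IsCyclotomic) {u : HeightOneSpectrum (𝓞 L)}
    (hqu : (q : 𝓞 L) ∉ u.asIdeal) :
    Set.Finite {x : V.subgroupH1 q (μ.kerSubgroup ⊓ decomp (K := L) u) | q • x = 0} := by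
  obtain ⟨δ, hδ, hne⟩ := exists_mem_decomp_apply_ne_one_of_isCyclotomic hμ hqu
  exact finite_setOf_nsmul_eq_zero_subgroupH1_kerSubgroup_inf_decomp μ V hqu
    ⟨δ, hδ, fun h ↦ hne (ZpExtension.mem_kerSubgroup.mp h)⟩

omit [W.IsElliptic] in
/-- **`H¹(ker κ ⊓ D_v, E[p^∞]) → H¹(I_v, E[p^∞])` is injective** at a finite `v ∤ p` not split
completely (GLOBAL `GreenbergSelmer` currency, `W.resOfLe p` along `I_v ≤ ker κ ⊓ D_v`): the local
condition "trivial in `H¹(K_{∞,η}, E[p^∞])`" of `Sel_E(K_∞)_p` at `v ∤ p` IS the unramified one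
(Greenberg LNM 1716 §2; GV 2000 §2). Inflation along `Hi ↠ ker κ ⊓ D_v` then the LOCAL restriction
(`resSubgroup_inertia_injective_of_isPrimary`) = the global restriction then the inflation along
`I_𝔐 ∩ Hi ↠ I_v` (`resH1Hom_comp`). [cite: GreenbergLNM1716, §3 Lemma 3.3 (proof, p. 87)] -/
theorem resOfLe_inertia_injective_geomPrimaryTorsion (hpv : (p : 𝓞 K) ∉ v.asIdeal)
    (hns : ∃ δ ∈ decomp (K := K) v, δ ∉ κ.kerSubgroup)
    (hle : inertia (K := K) v ≤ κ.kerSubgroup ⊓ decomp (K := K) v) :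
    Function.Injective (W.resOfLe p hle) := by
  have hp : (p : ℕ).Prime := Fact.out
  let G : Type u := absoluteGaloisGroup (v.adicCompletion K)
  let Hi : Subgroup G := localSubgroup κ.kerSubgroup (v.adicCompletion K)
  let Hg : Subgroup (absoluteGaloisGroup K) := κ.kerSubgroup ⊓ decomp (K := K) v
  haveI : CharZero (v.adicCompletion K) :=
    charZero_of_injective_algebraMap (algebraMap K (v.adicCompletion K)).injective
  obtain ⟨w, hw⟩ := v.exists_spectralValuation
  obtain ⟨𝔐, h𝔐⟩ := v.localPrimesAbove_nonempty
  have hIeq : 𝔐.inertia G = absInertia (v.adicCompletion K) := v.inertia_eq_absInertia hw h𝔐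
  let I : Subgroup G := 𝔐.inertia G
  let N : Subgroup Hi := I.subgroupOf Hi
  -- the local action of `Γ_{K_v}` on `E[p^∞]` (through the chosen embedding), local to this proof
  letI : DistribMulAction G (geomPrimaryTorsion W p) :=
    DistribMulAction.compHom _ (absGaloisRestrict K (v.adicCompletion K)).toMonoidHom
  have hcont : ∀ b : geomPrimaryTorsion W p, Continuous fun σ : G ↦ σ • b := by
    intro b
    change Continuous fun σ : G ↦ absGaloisRestrict K (v.adicCompletion K) σ • b
    exact (W.continuous_smul_geomPrimaryTorsion p b).comp
      (absGaloisRestrict K (v.adicCompletion K)).continuous_toFun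
  have hB : ∀ b : geomPrimaryTorsion W p, ∃ k : ℕ, p ^ k • b = 0 := fun b ↦ by
    obtain ⟨k, hk⟩ := (AddCommGroup.mem_primaryComponent).mp b.2
    exact ⟨k, Subtype.ext (by rw [AddSubgroupClass.coe_nsmul, hk, ZeroMemClass.coe_zero])⟩
  have hns' : ∃ σ : G, σ ∉ Hi :=
    (exists_not_mem_localSubgroup_iff_exists_mem_decomp κ).mpr hns
  -- the LOCAL restriction is injective
  have hloc := resSubgroup_inertia_injective_of_isPrimary κ hpv hns' h𝔐
    (B := geomPrimaryTorsion W p) hB hcont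
  -- the two inflations
  let θ : Hi →ₜ* Hg :=
    { toFun := fun x ↦ ⟨absGaloisRestrict K (v.adicCompletion K) x,
        ⟨(mem_localSubgroup_iff _ _ (x : G)).mp x.2, ⟨(x : G), rfl⟩⟩⟩
      map_one' := Subtype.ext (by simp)
      map_mul' := fun x y ↦ Subtype.ext (by simp)
      continuous_toFun :=
        ((absGaloisRestrict K (v.adicCompletion K)).continuous_toFun.comp
          continuous_subtype_val).subtype_mk _ }
  have hθ : Function.Surjective θ := by
    rintro ⟨y, hyk, ⟨x, rfl⟩⟩
    exact ⟨⟨x, (mem_localSubgroup_iff _ _ x).mpr hyk⟩, rfl⟩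
  have hinfl := resH1Hom_injective_of_surjective (M := geomPrimaryTorsion W p) θ hθ fun _ _ ↦ rfl
  let θI : N →ₜ* inertia (K := K) v :=
    { toFun := fun x ↦ ⟨absGaloisRestrict K (v.adicCompletion K) ((x : Hi) : G),
        Subgroup.mem_map_of_mem _ (by
          have hx : ((x : Hi) : G) ∈ 𝔐.inertia G := Subgroup.mem_subgroupOf.mp x.2
          rw [hIeq] at hx
          exact hx)⟩
      map_one' := Subtype.ext (by simp)
      map_mul' := fun x y ↦ Subtype.ext (by simp)
      continuous_toFun :=
        ((absGaloisRestrict K (v.adicCompletion K)).continuous_toFun.comp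
          (continuous_subtype_val.comp continuous_subtype_val)).subtype_mk _ }
  -- the square of restrictions commutes
  have hsq : (ResKernel.resSubgroup N (geomPrimaryTorsion W p)).comp
        (resH1Hom θ (AddMonoidHom.id _) fun _ _ ↦ rfl) =
      (resH1Hom θI (AddMonoidHom.id _) fun _ _ ↦ rfl).comp (W.resOfLe p hle) := by
    unfold ResKernel.resSubgroup WeierstrassCurve.resOfLe Literature.NumberTheory.EllipticCurves.resOfLe
    rw [resH1Hom_comp, resH1Hom_comp]
    exact resH1Hom_congr (ContinuousMonoidHom.ext fun _ ↦ rfl) (AddMonoidHom.ext fun _ ↦ rfl) _ _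
  have hcomp : Function.Injective ((ResKernel.resSubgroup N (geomPrimaryTorsion W p)).comp
      (resH1Hom θ (AddMonoidHom.id _) fun _ _ ↦ rfl)) := by
    rw [AddMonoidHom.coe_comp]
    exact hloc.comp hinfl
  rw [hsq, AddMonoidHom.coe_comp] at hcomp
  exact hcomp.of_comp

end Global

end Summit.BirchSwinnertonDyer.Rank1Residual.Iwasawa.NonsplitTower

end
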